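import Literature.AnabelianGeometry.EtaleTheta.Discharge.Sec5Thm56EndKnitLevelNYddRoofs
import Literature.AnabelianGeometry.EtaleTheta.Discharge.Sec5Thm56EndKnitLevelNRoofsGalois
import HarnessLib

/-!
# [EtTh] Prop. 5.5 ⊕ Thm. 5.6 (i) at the genuine level-`N` §5 data — END-KNIT swap pass layer 3d (`_levelN_projPin_Ydd`: the setting built on `Ÿ`, no `hH` binder), ROOF FORM,
# ON THE v2 SUBQUOTIENT RECORD `ThetaSubquotientProjGalois` (surjective at Galois objects only; proof-only)

S. Mochizuki, *The étale theta function and its Frobenioid-theoretic manifestations*, Publ. RIMS **45** (2009) [MochizukiEtTh2009],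
Prop. 5.5 p.327, proof p.328 (PDF p.102) l.2–11 (transport by ROOFS `S″ → S`, `S″ → S′`); Thm. 5.6 p.328, proof p.329 (PDF p.103);
§5 p.327 (PDF p.101) «these subquotients determine subquotients `Aut_D(D) ↠ Aut^Θ_D(D)`»
[cite: MochizukiEtTh2009, Prop 5.5 p.327 (PDF p.101)] [cite: MochizukiEtTh2009, Thm 5.6 p.328 (PDF p.102)].

abc-iut cell, layer L2, seat abc-iut-w6-d077 (gen 9); cone nodes EtTh:Prop5.5 / EtTh:Thm5.6(i); row «(w4-R2) V1→V2 PORT — the minimal ROOF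
chain to the fewest-binder end knit `_forall_roofs`» (booked UNHELD by abc-iut-w5-d013 g7 02:55:31Z), FILE 4.  PROOF-ONLY (0 definitions;
nothing landed is edited or restated).

abc-iut-w5-d013's roof twin `…_levelN_projPin_Ydd_roofs` (`Sec5Thm56EndKnitLevelNYddRoofs`) — the level-`N` END KNIT at the setting built on `Ÿ`
(abc-iut-w4-d042: `A_⊙^bs := Ÿ`, so `hH` «`Π^tp_Ÿ ⊆ H_⊙`» is a theorem and drops) —
bind abc-iut-L2-t4's v1 record `(P : ThetaSubquotientProj 𝔉_N)` (surjective at EVERY base object; no v1 term exists: EMPTY at the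
root-model stub, p476337).  Here the SAME proofs are re-run VERBATIM on abc-iut-w6-d079's v2 record `(P : ThetaSubquotientProjGalois 𝔉_N Gal)`
(p481123), for which abc-iut-w5-d051 has CONSTRUCTED a pinned term at exactly this data (p489319 `exists_thetaSubquotientProjGalois_pinned_levelStub`),
over this seat's twin(s) one layer down (`…_levelN_projPin_roofs_galois` (FILE 3, `Sec5Thm56EndKnitLevelNRoofsGalois`)); every `P`-free producer is consumed BY NAME exactly as in the v1 file (not restated).  The v1
theorems are the `P.toGalois` instances of these.  Conclusion of each: `∃ ρ, P.IsKummerDetermined ρ hB ∧ IsFunctorialLinear ρ ∧ (uniqueness) ∧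
CyclotomicRigidityPreserved Ψ ρ aΨ` on the v2 record.

* **`exists_rigidityFamily_unique_preserved_ofConnectedTemperoidData_levelN_projPin_Ydd_roofs_galois`**.

HONEST FRAMING: a typing repair of the cell's OWN record (weaker quantifier on `P`); kernel-checked implications between typed statements about
the genuine §5 data; the roofs, their meeting, `P` and its pins, the Prop. 5.2 (iii) pin, the transports and the model hypotheses are HYPOTHESES
here, not asserted; nothing asserts that such data exist for an actual curve; [EtTh]/[SemiAnbd] are refereed pre-IUT material; nothing here
bears on [IUTchIII] Cor. 3.12 — no side is taken; typed ≠ proved; nothing here asserts abc proved or refuted.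
-/

noncomputable section

namespace Literature.AnabelianGeometry.EtaleTheta

open CategoryTheory Opposite FrobenioidCyclotomicRigidity Literature.AlgebraicGeometry.Frobenioids
  Literature.AnabelianGeometry.SemiGraphs Literature.AnabelianGeometry.SemiGraphs.GaloisObjects

universe u₀ v₀ w' v₁ u₁

namespace ThetaFrobenioid

section YddProjPin

variable {K : Type u₀} [Field K] {X : SemiGraphs.TemperedArithmeticGroup.{u₀} K} {D₀ : Type u₀} [Category.{v₀} D₀]
  {V : FrdIMonoidStub.{max u₀ w'}} {T₀ : RealifiedDivisorMonoids (D₀ := D₀) V}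
  {VD : FrdICatStub.{u₀ + 1, u₀, max u₀ w'} (ConnectedPart (BTemp X.Pi))}
  {tf : TemperedFrobenioid T₀ (ConnectedPart (BTemp X.Pi)) VD} {hZ : tf.monoidType = MonoidType.Z}
  {hP : ∀ A : (ConnectedPart (BTemp X.Pi))ᵒᵖ, IsPerfect (tf.Φ.carrier A)}
  {NH : Subgroup (Field.absoluteGaloisGroup K) → tf.category → ℕ+ → Prop}
  {lv N : ℕ+} {l' : ℕ} {RD : RigidData.{max u₀ w'} N l'} {ιX : RD.PiX ≃ₜ* X.Pi}
  {pullFrac : ∀ {A A' : (BiKummerSetting.mkOfConnectedTemperoidYdd X tf hZ hP NH RD.toThetaEnvData ιX).C} (_ : A' ⟶ A),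
    (BiKummerSetting.mkOfConnectedTemperoidYdd X tf hZ hP NH RD.toThetaEnvData ιX).biratUnits A →
      (BiKummerSetting.mkOfConnectedTemperoidYdd X tf hZ hP NH RD.toThetaEnvData ιX).biratUnits A'}
  {θ : (BiKummerSetting.mkOfConnectedTemperoidYdd X tf hZ hP NH RD.toThetaEnvData ιX).biratUnits
    (BiKummerSetting.mkOfConnectedTemperoidYdd X tf hZ hP NH RD.toThetaEnvData ιX).Aodot}
  {Bl : (BiKummerSetting.mkOfConnectedTemperoidYdd X tf hZ hP NH RD.toThetaEnvData ιX).C}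
  {Pl : (BiKummerSetting.mkOfConnectedTemperoidYdd X tf hZ hP NH RD.toThetaEnvData ιX).FractionPair θ Bl}
  {Rl : (BiKummerSetting.mkOfConnectedTemperoidYdd X tf hZ hP NH RD.toThetaEnvData ιX).NthRoot θ Pl lv pullFrac}
  [RD.iotaN.range.Normal]
  (h : ModelFrobenioid.Hypotheses tf.divisorMonoid tf.ratFnFunctor) (odd_l : Odd (lv : ℕ))
  (R : (BiKummerSetting.mkOfConnectedTemperoidYdd X tf hZ hP NH RD.toThetaEnvData ιX).NthRoot Rl.root Rl.pair N pullFrac)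
  (K' : Type (max u₀ w')) [Field K'] (constEmb : K'ˣ →* tf.biratUnitsModel R.BN) (constEmb_injective : Function.Injective constEmb)
  (hinvc : ∀ g : Aut R.AN.base,
    pull tf.divisorMonoid g.hom (ModelFrobenioid.div R.pair.num) = ModelFrobenioid.div R.pair.num)
  (hinvp : ∀ y : RD.PiX, y ∈ RD.PiYdd →
    pull tf.divisorMonoid ((BiKummerSetting.mkOfConnectedTemperoidYdd X tf hZ hP NH RD.toThetaEnvData ιX).galoisSurj R.AN.base
      R.αData.isGalois (ιX y)).hom (ModelFrobenioid.div R.pair.den) = ModelFrobenioid.div R.pair.den)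
  {Gal : ConnectedPart (BTemp X.Pi) → Prop}

/-- (v2 record; abc-iut-w5-d013ʼs roof twin VERBATIM, `P` re-typed `ThetaSubquotientProjGalois _ Gal`.)
**ROOF TWIN (on the v2 record) of `exists_rigidityFamily_unique_preserved_ofConnectedTemperoidData_levelN_projPin_Ydd`** — the projection-pin END KNIT at the setting built on `Ÿ` (`mkOfConnectedTemperoidYdd`), where `hH : Π^tp_Ÿ ⊆ H_⊙` is a theorem (`BiKummerSetting.hH_mkOfConnectedTemperoidYdd`); binder delta: `hreach ↦ hroof + hmeet`, `hpull` linear-only; statement and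
proof otherwise verbatim the original's (module docstring).  [cite: MochizukiEtTh2009, Thm 5.6 p.328 (PDF p.102); Prop 5.5 proof p.328 (PDF p.102)] -/
theorem exists_rigidityFamily_unique_preserved_ofConnectedTemperoidData_levelN_projPin_Ydd_roofs_galois
    -- Prop 5.5 side (η / ν pin, reachability, stub laws)
    (hB : (ofConnectedTemperoidData h (RD.levelStub ιX) odd_l R ιX K' constEmb constEmb_injective hinvc hinvp).IsThetaSaturated (ofConnectedTemperoidData h (RD.levelStub ιX) odd_l R ιX K' constEmb constEmb_injective hinvc hinvp).BN) (P : ThetaSubquotientProjGalois (ofConnectedTemperoidData h (RD.levelStub ιX) odd_l R ιX K' constEmb constEmb_injective hinvc hinvp) Gal)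
    -- the ONE pin: `P` at `B_N^bs` is print's `Aut`-subquotient domain `autPre q_N ι_N` read through `Aut_D(B_N^bs) ↪ Aut(B_N^bs.obj)`
    -- (abc-iut-w4-d042's `hPpre`; DUAL CLAUSE G-w4d042g3-1: no `P`-TERM until v-next `proj_surjective_of_isGaloisObj`)
    (hPpre : P.pre R.BN.base =
      (ThetaSubquotient.autPre (RD.qN ιX) RD.iotaN R.BN.base.obj).comap (Functor.mapAut R.BN.base (connectedObjects (BTemp X.Pi)).ι))
    -- the SECOND pin (abc-iut-w4-d042): `P.proj` at `B_N^bs` IS print's `autProj` read through `Aut_D(B_N^bs) ↪ Aut(B_N^bs.obj)` (cast-free form)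
    (hPproj_pin : ∀ (σ : P.pre R.BN.base) (τ : ThetaSubquotient.autPre (RD.qN ιX) RD.iotaN R.BN.base.obj),
      Functor.mapAut R.BN.base (connectedObjects (BTemp X.Pi)).ι (σ : Aut R.BN.base) = (τ : Aut R.BN.base.obj) →
        (P.proj R.BN.base σ : ThetaSubquotient.LDelta (RD.qN ιX) RD.iotaN R.BN.base.obj) =
          ThetaSubquotient.autProj (RD.qN ιX) RD.iotaN R.BN.base.obj τ)
    {η₀ : RD.PiYdd → RD.mu} (hη₀ : η₀ ∈ RD.thetaCocycles)
    (hdies : ∀ k : RD.PiYdd, rhoOfBiKummerData R ιX k = 1 → η₀ k = 1)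
    (ν : (ofConnectedTemperoidData h (RD.levelStub ιX) odd_l R ιX K' constEmb constEmb_injective hinvc hinvp).lDeltaModN (ofConnectedTemperoidData h (RD.levelStub ιX) odd_l R ιX K' constEmb constEmb_injective hinvc hinvp).BN ≃* (ofConnectedTemperoidData h (RD.levelStub ιX) odd_l R ιX K' constEmb constEmb_injective hinvc hinvp).muTorsion (ofConnectedTemperoidData h (RD.levelStub ιX) odd_l R ιX K' constEmb constEmb_injective hinvc hinvp).BN (ofConnectedTemperoidData h (RD.levelStub ιX) odd_l R ιX K' constEmb constEmb_injective hinvc hinvp).N)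
    -- hKν with the coefficient map ELIMINATED (abc-iut-w4-d042): «η ∘ ρ = e ∘ η₀» reads «η(ρ k) = mk (P.proj (ρ k'))» whenever `thetaMod k' = η₀ k`
    (hKν : ∀ η : (ofConnectedTemperoidData h (RD.levelStub ιX) odd_l R ιX K' constEmb constEmb_injective hinvc hinvp).HB → (ofConnectedTemperoidData h (RD.levelStub ιX) odd_l R ιX K' constEmb constEmb_injective hinvc hinvp).lDeltaModN (ofConnectedTemperoidData h (RD.levelStub ιX) odd_l R ιX K' constEmb constEmb_injective hinvc hinvp).BN,
      (∀ (k k' : RD.PiYdd) (hk' : (k' : RD.PiX) ∈ RD.lDeltaTheta) (hm' : rhoOfBiKummerData R ιX k' ∈ P.pre _),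
          RD.thetaMod ⟨k', hk'⟩ = η₀ k →
            η ⟨rhoOfBiKummerData R ιX k, Subgroup.mem_map_of_mem _ k.2⟩ =
              (QuotientGroup.mk (P.proj _ ⟨rhoOfBiKummerData R ιX k', hm'⟩) : (ofConnectedTemperoidData h (RD.levelStub ιX) odd_l R ιX K' constEmb constEmb_injective hinvc hinvp).lDeltaModN (ofConnectedTemperoidData h (RD.levelStub ιX) odd_l R ιX K' constEmb constEmb_injective hinvc hinvp).BN)) →
        FrobenioidThetaBiKummer.ThetaPairKummerClass (ofConnectedTemperoidData h (RD.levelStub ιX) odd_l R ιX K' constEmb constEmb_injective hinvc hinvp) η ν)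
    -- T56-L09b: Prop 3.4 (ii) constants + the origin clause «cnst kills Ker aug» (G-w5d020-2)
    {Dcnst : Type u₁} [Category.{v₁} Dcnst] {cnst : D₀ ⥤ Dcnst} (hP34 : RealifiedDivisorMonoids.Prop34Cnst T₀ cnst)
    (hΔcnst : ∀ δ ∈ RD.aug.ker,
      cnst.map (tf.base.map (rhoOfBiKummerData R ιX δ).hom) = 𝟙 (cnst.obj (tf.base.obj R.BN.base)))
    -- print's ROOFS (replacing `hreach`): one roof per theta-saturated object, and two roofs of `T` meet
    (hroof : ∀ T : (BiKummerSetting.mkOfConnectedTemperoidYdd X tf hZ hP NH RD.toThetaEnvData ιX).C, (ofConnectedTemperoidData h (RD.levelStub ιX) odd_l R ιX K' constEmb constEmb_injective hinvc hinvp).IsThetaSaturated T →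
      ∃ (R' : (BiKummerSetting.mkOfConnectedTemperoidYdd X tf hZ hP NH RD.toThetaEnvData ιX).C) (_ : (ofConnectedTemperoidData h (RD.levelStub ιX) odd_l R ιX K' constEmb constEmb_injective hinvc hinvp).IsThetaSaturated R') (a : R' ⟶ T) (b : R' ⟶ (ofConnectedTemperoidData h (RD.levelStub ιX) odd_l R ιX K' constEmb constEmb_injective hinvc hinvp).BN),
        (ofConnectedTemperoidData h (RD.levelStub ιX) odd_l R ιX K' constEmb constEmb_injective hinvc hinvp).IsLinear a ∧ (ofConnectedTemperoidData h (RD.levelStub ιX) odd_l R ιX K' constEmb constEmb_injective hinvc hinvp).IsLinear b ∧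
        Function.Surjective ((ofConnectedTemperoidData h (RD.levelStub ιX) odd_l R ιX K' constEmb constEmb_injective hinvc hinvp).lDeltaModNMap a) ∧ Function.Injective ((ofConnectedTemperoidData h (RD.levelStub ιX) odd_l R ιX K' constEmb constEmb_injective hinvc hinvp).muTorsionPull a (ofConnectedTemperoidData h (RD.levelStub ιX) odd_l R ιX K' constEmb constEmb_injective hinvc hinvp).N) ∧
        Function.Surjective ((ofConnectedTemperoidData h (RD.levelStub ιX) odd_l R ιX K' constEmb constEmb_injective hinvc hinvp).lDeltaModNMap b) ∧ Function.Injective ((ofConnectedTemperoidData h (RD.levelStub ιX) odd_l R ιX K' constEmb constEmb_injective hinvc hinvp).muTorsionPull b (ofConnectedTemperoidData h (RD.levelStub ιX) odd_l R ιX K' constEmb constEmb_injective hinvc hinvp).N))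
    (hmeet : ∀ (T : (BiKummerSetting.mkOfConnectedTemperoidYdd X tf hZ hP NH RD.toThetaEnvData ιX).C), (ofConnectedTemperoidData h (RD.levelStub ιX) odd_l R ιX K' constEmb constEmb_injective hinvc hinvp).IsThetaSaturated T →
      ∀ (R₁ : (BiKummerSetting.mkOfConnectedTemperoidYdd X tf hZ hP NH RD.toThetaEnvData ιX).C), (ofConnectedTemperoidData h (RD.levelStub ιX) odd_l R ιX K' constEmb constEmb_injective hinvc hinvp).IsThetaSaturated R₁ → ∀ (a : R₁ ⟶ T), (ofConnectedTemperoidData h (RD.levelStub ιX) odd_l R ιX K' constEmb constEmb_injective hinvc hinvp).IsLinear a →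
      ∀ (R₂ : (BiKummerSetting.mkOfConnectedTemperoidYdd X tf hZ hP NH RD.toThetaEnvData ιX).C), (ofConnectedTemperoidData h (RD.levelStub ιX) odd_l R ιX K' constEmb constEmb_injective hinvc hinvp).IsThetaSaturated R₂ → ∀ (a' : R₂ ⟶ T), (ofConnectedTemperoidData h (RD.levelStub ιX) odd_l R ιX K' constEmb constEmb_injective hinvc hinvp).IsLinear a' →
      ∃ (R₀ : (BiKummerSetting.mkOfConnectedTemperoidYdd X tf hZ hP NH RD.toThetaEnvData ιX).C) (_ : (ofConnectedTemperoidData h (RD.levelStub ιX) odd_l R ιX K' constEmb constEmb_injective hinvc hinvp).IsThetaSaturated R₀) (c : R₀ ⟶ R₁) (c' : R₀ ⟶ R₂),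
        (ofConnectedTemperoidData h (RD.levelStub ιX) odd_l R ιX K' constEmb constEmb_injective hinvc hinvp).IsLinear c ∧ (ofConnectedTemperoidData h (RD.levelStub ιX) odd_l R ιX K' constEmb constEmb_injective hinvc hinvp).IsLinear c' ∧ (ofConnectedTemperoidData h (RD.levelStub ιX) odd_l R ιX K' constEmb constEmb_injective hinvc hinvp).base.map (c ≫ a) = (ofConnectedTemperoidData h (RD.levelStub ιX) odd_l R ιX K' constEmb constEmb_injective hinvc hinvp).base.map (c' ≫ a') ∧
        Function.Surjective ((ofConnectedTemperoidData h (RD.levelStub ιX) odd_l R ιX K' constEmb constEmb_injective hinvc hinvp).lDeltaModNMap c') ∧ Function.Injective ((ofConnectedTemperoidData h (RD.levelStub ιX) odd_l R ιX K' constEmb constEmb_injective hinvc hinvp).muTorsionPull c' (ofConnectedTemperoidData h (RD.levelStub ιX) odd_l R ιX K' constEmb constEmb_injective hinvc hinvp).N))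
    -- hKR (G-L6t23-3) by abc-iut-w4-d099's PIN route (p-file Sec5ThetaSectionCompatOfKummerClass): «Prop 5.2 (iii) enters ONCE» —
    -- the (η₀, ν) pin above + Facts + the cyclotome dictionary m with m ∘ ν ∘ e = id + cyclotomic-character compatibility (F-1306)
    (H : (ofConnectedTemperoidData h (RD.levelStub ιX) odd_l R ιX K' constEmb constEmb_injective hinvc hinvp).Facts)
    (m : (ofConnectedTemperoidData h (RD.levelStub ιX) odd_l R ιX K' constEmb constEmb_injective hinvc hinvp).muTorsion (ofConnectedTemperoidData h (RD.levelStub ιX) odd_l R ιX K' constEmb constEmb_injective hinvc hinvp).BN (ofConnectedTemperoidData h (RD.levelStub ιX) odd_l R ιX K' constEmb constEmb_injective hinvc hinvp).N ≃* RD.mu)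
    -- hme with the coefficient map ELIMINATED (abc-iut-w4-d042): `m ∘ ν ∘ e = id` reads `m (ν (mk (P.proj (ρ k)))) = thetaMod k` on `Π^tp_Ÿ ∩ (l·Δ_Θ)`
    (hme : ∀ (k : RD.PiYdd) (hk : (k : RD.PiX) ∈ RD.lDeltaTheta) (hm : rhoOfBiKummerData R ιX k ∈ P.pre _),
      m (ν (QuotientGroup.mk (P.proj _ ⟨rhoOfBiKummerData R ιX k, hm⟩) : (ofConnectedTemperoidData h (RD.levelStub ιX) odd_l R ιX K' constEmb constEmb_injective hinvc hinvp).lDeltaModN (ofConnectedTemperoidData h (RD.levelStub ιX) odd_l R ιX K' constEmb constEmb_injective hinvc hinvp).BN)) = RD.thetaMod ⟨k, hk⟩)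
    (hχX : (ofConnectedTemperoidData h (RD.levelStub ιX) odd_l R ιX K' constEmb constEmb_injective hinvc hinvp).CyclotomicCharacterCompatX RD.toThetaEnvData (MulEquiv.refl _) m)
    -- Thm 5.6 side: Ψ, its base shadow, Δ-transport and μ-pull data (abc-iut-L2-d4)
    (Ψ : (BiKummerSetting.mkOfConnectedTemperoidYdd X tf hZ hP NH RD.toThetaEnvData ιX).C ≌ (BiKummerSetting.mkOfConnectedTemperoidYdd X tf hZ hP NH RD.toThetaEnvData ιX).C) (Ψbs : ConnectedPart (BTemp X.Pi) ⥤ ConnectedPart (BTemp X.Pi)) [Ψbs.IsEquivalence] (eΨ : Ψ.functor ⋙ (ofConnectedTemperoidData h (RD.levelStub ιX) odd_l R ιX K' constEmb constEmb_injective hinvc hinvp).base ≅ (ofConnectedTemperoidData h (RD.levelStub ιX) odd_l R ιX K' constEmb constEmb_injective hinvc hinvp).base ⋙ Ψbs)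
    (aΨ : ∀ A : (BiKummerSetting.mkOfConnectedTemperoidYdd X tf hZ hP NH RD.toThetaEnvData ιX).C, (ofConnectedTemperoidData h (RD.levelStub ιX) odd_l R ιX K' constEmb constEmb_injective hinvc hinvp).lDeltaModN A ≃* (ofConnectedTemperoidData h (RD.levelStub ιX) odd_l R ιX K' constEmb constEmb_injective hinvc hinvp).lDeltaModN (Ψ.functor.obj A))
    (hlin : PreFrobenioidData.PreservesMor Ψ.functor (ofConnectedTemperoidData h (RD.levelStub ιX) odd_l R ιX K' constEmb constEmb_injective hinvc hinvp).IsLinear (ofConnectedTemperoidData h (RD.levelStub ιX) odd_l R ιX K' constEmb constEmb_injective hinvc hinvp).IsLinear)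
    (haΨn : ∀ {A A' : (BiKummerSetting.mkOfConnectedTemperoidYdd X tf hZ hP NH RD.toThetaEnvData ιX).C} (φ : A ⟶ A') (x : (ofConnectedTemperoidData h (RD.levelStub ιX) odd_l R ιX K' constEmb constEmb_injective hinvc hinvp).lDeltaModN A),
      aΨ A' ((ofConnectedTemperoidData h (RD.levelStub ιX) odd_l R ιX K' constEmb constEmb_injective hinvc hinvp).lDeltaModNMap φ x) = (ofConnectedTemperoidData h (RD.levelStub ιX) odd_l R ιX K' constEmb constEmb_injective hinvc hinvp).lDeltaModNMap (Ψ.functor.map φ) (aΨ A x))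
    (hpull : ∀ {A A' : (BiKummerSetting.mkOfConnectedTemperoidYdd X tf hZ hP NH RD.toThetaEnvData ιX).C} (φ : A ⟶ A'), (ofConnectedTemperoidData h (RD.levelStub ιX) odd_l R ιX K' constEmb constEmb_injective hinvc hinvp).IsLinear φ → ∀ (u : (ofConnectedTemperoidData h (RD.levelStub ιX) odd_l R ιX K' constEmb constEmb_injective hinvc hinvp).muTorsion A' (ofConnectedTemperoidData h (RD.levelStub ιX) odd_l R ιX K' constEmb constEmb_injective hinvc hinvp).N)
      (hu : Ψ.functor.mapAut A' u.1 ∈ (ofConnectedTemperoidData h (RD.levelStub ιX) odd_l R ιX K' constEmb constEmb_injective hinvc hinvp).muTorsion (Ψ.functor.obj A') (ofConnectedTemperoidData h (RD.levelStub ιX) odd_l R ιX K' constEmb constEmb_injective hinvc hinvp).N),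
      Ψ.functor.mapAut A ((ofConnectedTemperoidData h (RD.levelStub ιX) odd_l R ιX K' constEmb constEmb_injective hinvc hinvp).muTorsionPull φ (ofConnectedTemperoidData h (RD.levelStub ιX) odd_l R ιX K' constEmb constEmb_injective hinvc hinvp).N u).1 = ((ofConnectedTemperoidData h (RD.levelStub ιX) odd_l R ιX K' constEmb constEmb_injective hinvc hinvp).muTorsionPull (Ψ.functor.map φ) (ofConnectedTemperoidData h (RD.levelStub ιX) odd_l R ιX K' constEmb constEmb_injective hinvc hinvp).N ⟨_, hu⟩).1)
    -- the NORMALISED Thm 5.7 transport (D_c = 1, e = 1: abc-iut-L2-d4 T1 + abc-iut-w5-d245 `capCupTransport_normalise`)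
    (α : Ψ.functor.obj (ofConnectedTemperoidData h (RD.levelStub ιX) odd_l R ιX K' constEmb constEmb_injective hinvc hinvp).AN ≅ (ofConnectedTemperoidData h (RD.levelStub ιX) odd_l R ιX K' constEmb constEmb_injective hinvc hinvp).AN) (β : Ψ.functor.obj (ofConnectedTemperoidData h (RD.levelStub ιX) odd_l R ιX K' constEmb constEmb_injective hinvc hinvp).BN ≅ (ofConnectedTemperoidData h (RD.levelStub ιX) odd_l R ιX K' constEmb constEmb_injective hinvc hinvp).BN) {Dp₀ : Aut (ofConnectedTemperoidData h (RD.levelStub ιX) odd_l R ιX K' constEmb constEmb_injective hinvc hinvp).BN}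
    (hc₁ : α.inv ≫ Ψ.functor.map (ofConnectedTemperoidData h (RD.levelStub ιX) odd_l R ιX K' constEmb constEmb_injective hinvc hinvp).sCap ≫ β.hom = (ofConnectedTemperoidData h (RD.levelStub ιX) odd_l R ιX K' constEmb constEmb_injective hinvc hinvp).sCap)
    (hp₁ : α.inv ≫ Ψ.functor.map (ofConnectedTemperoidData h (RD.levelStub ιX) odd_l R ιX K' constEmb constEmb_injective hinvc hinvp).sCup ≫ β.hom = (ofConnectedTemperoidData h (RD.levelStub ιX) odd_l R ιX K' constEmb constEmb_injective hinvc hinvp).sCup ≫ Dp₀.hom) (hDp₀ : Dp₀ ∈ (ofConnectedTemperoidData h (RD.levelStub ιX) odd_l R ιX K' constEmb constEmb_injective hinvc hinvp).units (ofConnectedTemperoidData h (RD.levelStub ιX) odd_l R ιX K' constEmb constEmb_injective hinvc hinvp).BN)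
    -- [FrdI] Prop 5.6 / Thm 3.4 (iii) data at A_N (abc-iut-w5-d245's Prop 5.6 unit)
    -- the MODEL HYPOTHESES of [FrdI] Thm 3.4 (iii)/(v) at the §4 tempered Frobenioid ([EtTh] Thm 3.7 (i)(ii))
    (hD : IsOfFSMType (ConnectedPart (BTemp X.Pi))) (hslim : IsSlim (ConnectedPart (BTemp X.Pi))) (hnd : IsNonDilatingOn tf.divisorMonoid)
    (hN : ∃ A : (BiKummerSetting.mkOfConnectedTemperoidYdd X tf hZ hP NH RD.toThetaEnvData ιX).C, ¬ (PreFrobenioidData.ofModel tf.divisorMonoid tf.ratFnFunctor tf.divBNatTrans).IsGroupLikeObj A)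
    -- [EtTh] Cor 2.18 (i): the theta-related subquotients Π^tp_Ÿ, (l·Δ_Θ), … of Π^tp_X are CHARACTERISTIC (abc-iut-L2-t2's
    -- `RigidData.Cor218_i`, F-0620; discharged at the model data by abc-iut-L2-t8/L6) — supplies hP24/hγL for EVERY γ
    (h218i : RD.Cor218_i)
    -- T56-L09c in its γ-FREE typed form (abc-iut-w5-d020's `Thm56Sub.DeltaTransportCompat`): at B_N the Δ-transport (aΨ, β)
    -- agrees on P.pre with the map induced by the B_N-transport θ′ of every admissible base shadow θA (no γ mentioned)
    (hΔ : ∀ θA : Aut R.AN.base ≃* Aut R.AN.base,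
      (∀ f : Aut R.AN, (PreFrobenioid.baseFunctor (BiKummerSetting.mkOfConnectedTemperoidYdd X tf hZ hP NH RD.toThetaEnvData ιX).F).mapIso (α.symm ≪≫ Ψ.functor.mapIso f ≪≫ α) =
        θA ((PreFrobenioid.baseFunctor (BiKummerSetting.mkOfConnectedTemperoidYdd X tf hZ hP NH RD.toThetaEnvData ιX).F).mapIso f)) →
      Thm56Sub.DeltaTransportCompatGal (ofConnectedTemperoidData h (RD.levelStub ιX) odd_l R ιX K' constEmb constEmb_injective hinvc hinvp) Ψ β aΨ (((ofConnectedTemperoidData h (RD.levelStub ιX) odd_l R ιX K' constEmb constEmb_injective hinvc hinvp).autBaseIsoAB.symm.trans θA).trans (ofConnectedTemperoidData h (RD.levelStub ιX) odd_l R ιX K' constEmb constEmb_injective hinvc hinvp).autBaseIsoAB) P) :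
    ∃ ρ : RigidityFamily (ofConnectedTemperoidData h (RD.levelStub ιX) odd_l R ιX K' constEmb constEmb_injective hinvc hinvp), P.IsKummerDetermined ρ hB ∧ IsFunctorialLinear (ofConnectedTemperoidData h (RD.levelStub ιX) odd_l R ιX K' constEmb constEmb_injective hinvc hinvp) ρ ∧
      (∀ ρ' : RigidityFamily (ofConnectedTemperoidData h (RD.levelStub ιX) odd_l R ιX K' constEmb constEmb_injective hinvc hinvp), P.IsKummerDetermined ρ' hB → IsFunctorialLinear (ofConnectedTemperoidData h (RD.levelStub ιX) odd_l R ιX K' constEmb constEmb_injective hinvc hinvp) ρ' → ρ' = ρ) ∧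
      CyclotomicRigidityPreserved (ofConnectedTemperoidData h (RD.levelStub ιX) odd_l R ιX K' constEmb constEmb_injective hinvc hinvp) Ψ ρ aΨ :=
  exists_rigidityFamily_unique_preserved_ofConnectedTemperoidData_levelN_projPin_roofs_galois.{u₀, v₀, w', v₁, u₁} h odd_l R ιX K' constEmb
    constEmb_injective hinvc hinvp hB P hPpre hPproj_pin hη₀ hdies ν hKν hP34 hΔcnst hroof hmeet H m hme hχX
    (BiKummerSetting.hH_mkOfConnectedTemperoidYdd X tf hZ hP NH RD.toThetaEnvData ιX) Ψ Ψbs eΨ aΨ hlin haΨn hpull α β hc₁ hp₁ hDp₀ hD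
    hslim hnd hN h218i hΔ

end YddProjPin

end ThetaFrobenioid

end Literature.AnabelianGeometry.EtaleTheta

end
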